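import Summits.Ventures.AbcSig.Conjectures.LevelRaising32L2Instance313Inertia2

/-!
# Venture AbcSig — the slice of `CONJ_LR32_L2` at `ℓ = 313`: CLASS FORCING on the CONCLUSION side

HONEST FRAMING. Support file of the computation cell `pub-abcsig` (p-lean g23; lead g20 KEY «L313-CLASS-FORCING»,
HOME/wake/KEY-pub-abcsig-p-lean-L313-CLASS-FORCING.md 7cb5bab556a95699). WHAT IS NEW, IN ONE SENTENCE: **the survivor class is FORCED on the
conclusion's exponent `m`, not assumed on the premise's `κ`.** READ FIRST `Conjectures/LevelRaising32L2Instance313R8.lean` (p539869: `CONJ_LR32_L2At_313_iff₈`, the EIGHT-class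
residual `LR32Residual313E` = NEGATIVE-21's classes `(E₁; 1, 313^m)`, `(E₁; 313^m, 1)`, `m ∈ {6, 10, 13, 17}`), `…Instance313Sympl.lean`
(p544524: the SYMPL survivor condition `23 ∣ m ∨ (m/23) = +1`, modulo `hX223` + `HS313`, `HS223`) and `…Instance313Inertia2.lean` (p551031:
the `(1+i)` socket `HI2`/`HI2Cells`). **Kernel face of `CONJ_LR32_L2` UNCHANGED by this file (62 PROVED + 1 REDUCED + 1 OOS / 64); Q(313; 23)
is NOT decided; typed ≠ proved; computed ≠ proved; no row of the paper; nothing about ABC or any summit.**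

THE POINT. In every kernel reading of the reduced slice so far (`_iff`, `_iff'`, `_iff₈`, `_iff_sympl`, `_iff_inertia2…`) NEGATIVE-21's eight
classes enter ONLY through the PREMISE `M.ArisesMod f 23 (lr32ClassAllowed 313 23 κ)`; the CONCLUSION («`f` is congruent above `23` to the
Frey curve of a primitive solution of `A a²³ + B b²³ = c²`, `A·B = 313^m` (`E₁`) or `2³·313^m` (`E₂`), `m ≥ 1`») leaves the exponent `m`
FREE — design decision (iii) of `CONJ_LR32_L2` («the conclusion's class is NOT forced to equal the premise's `κ`») — so the SYMPL survivor
condition had to read `23 ∣ m ∨ (m/23) = +1`, and `lr32_sympl_exponent_mod` (p544524) says «`m ≡ 6, −10`» only under the UNDISCHARGED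
residue hypothesis `hr : m % 23 ∈ [6, 10, 13, 17]`. THIS FILE PROVES the conclusion-side statement: **every `E₁` datum `S` (`A·B = 313^m`,
`C = 1`, `gcd(A, B) = 1`, `n = 23`) whose Frey curve is congruent above `23` to a newform of level `2⁵·313` matching the extended datum
`lr32X313` of `10016.1` has `m mod 23 ∈ {6, 10, 13, 17}`** — in particular `23 ∤ m` — modulo NOTHING new: the only non-kernel input is
p525413's COMPUTED same-newforms hypothesis `hX` (eigenvalues of `10016.1` at `47, 139, 277, 599, 1013`). Mechanism (all in the tree):
SOUNDNESS of the Kraus premise (`arisesMod_lr32ClassAllowed_of_congruentToFrey`, `Conjectures/LevelRaising32L2.lean` (b): a newform congruent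
to the Frey curve of an ACTUAL solution with `A·B` supported on `{313}` passes the Kraus table of the class `(E₁; A, B)`), applied to the
REDUCED datum (`m = 23k + r`: absorb `313^k` into `a` resp. `b` — same curve over every `ZMod q`, `q ≠ 313`, hence the same `freyTrace` and
the same multiplicative primes: `congruentToFrey_rescaleA/B`), then the kernel certificates against the class `(E₁; 313^r, 1)` / `(E₁; 1, 313^r)`:
the 32 `E₁` certificates of p525413 (`lr32Closed313_elim`), the 4 of p533475/p539869 at `q = 1013` (`lr32Killed1013_elim`), and ONE NEW
certificate at `q = 47` for the exponent-residue-`0` class `(E₁; 1, 1)` (outside `lr32Classes 313 23`; its table `[−48, 0, 48]` is the CM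
trace of `Y² = X³ ± X` from the trivial solution `1 + (−1) = 0`; `ψ(c₄₇) = ∓θ ≡ ±8 (mod 23)` misses it) — `lr32Elim313_E1_m0`, ≈ 1 s of
kernel time. A second new certificate `lr32Elim313_E2_m0` (class `(E₂; 1, 8)`, table `[−48, −12, 0, 12, 48]`) gives the `E₂` companion:
**no `E₂` datum in BS04's normalisation `B ∈ {8·313^m, 8}` (`2³ ‖ B`) is congruent above `23` to such a newform** (`lr32_E2_excluded`; the
other 42 + 2 `E₂` certificates are p525413's and p532105's).

CONSEQUENCES, TYPED. (1) `lr32_E1_class_forced`, `lr32_E1_not_dvd` (PROVED mod `hX`). (2) WITH SYMPL (`hX223` COMPUTED; `HS313`, `HS223`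
TYPED): `lr32_sympl_class : m % 23 = 6 ∨ m % 23 = 13` — `lr32_sympl_exponent_mod` with `hr` DISCHARGED: the registrar's survivor set
`{6, −10} × {D1, D2}` (HOME/STRUCTURE.md v3.29, registrar l.107) as a kernel statement about the SOLUTION the residual asserts, not only a label
on its premises. (3) `LR32Residual313Forced M 𝒯`: VERBATIM `LR32Residual313E M` except that the `E₁` branch of the conclusion carries
`m % 23 = 6 ∨ m % 23 = 13` and the `(1+i)` cell clause «case (i) as printed ⇒ `(v₂(c), B·b²³ mod 16) ∈ 𝒯`» (the (G) cell clause INSIDE the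
residual — p551031's socket `HI2Cells` carried into the conclusion, as p551031 did for the (F) bit «`4 ∣ z`», STRUCTURE v3.33, registrar
l.116; booked cells v3.34, registrar l.119), and the `E₂` branch carries `8 ∣ A` (the un-normalised distributions, which the typed conclusion
does not exclude and no certificate of record addresses); **`CONJ_LR32_L2At_313_iff_forced : CONJ_LR32_L2At M 313 ↔ LR32Residual313Forced M 𝒯`
modulo EXACTLY `hD`, `hCP`, `hX`, `hX223` (COMPUTED), `HS313`, `HS223` (TYPED) and `HI2Cells M 𝒯` (TYPED; booked instance
`inertia2CellsBooked`, COMPUTED: `CONJ_LR32_L2At_313_iff_forced_booked`; `𝒯 = Set.univ` — `HI2Cells M Set.univ` holds trivially — gives the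
reading without any `(1+i)` input).** (STRUCTURE v3.35–v3.37 are wording-only for this file.)

WHAT THIS IS NOT. Not a proof or refutation of `CONJ_LR32_L2At M 313` or of any residual (all OPEN); NOT a decision of Q(313; 23); the
statements of record (`CONJ_LR32_L2`, `CONJ_LR32_L2At`, `LR32Residual313`, `…E`, `…Sympl`, `…Inertia2`, p525413–p551031) are untouched;
the new certificates use p525413's datum `lr32X313` and nothing else; `HS313`, `HS223`, `HI2Cells` stay TYPED and `hX`, `hX223`, `hD`, `hCP`
COMPUTED; nothing about ABC or any summit. MEANINGFUL ONLY FOR THE INTENDED MODEL, like every statement over `NewformModel`.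
References: [BS04] M. A. Bennett, C. M. Skinner, Canad. J. Math. 56 (2004) 23–54, Lemma 4.2, Prop. 4.3; A. Kraus, Canad. J. Math. 49 (1997)
1139–1161. Cell records: HOME = run/shared/lean/pub/pub-abcsig/: STRUCTURE.md §8 (NEGATIVE-21) / §8b (au)-ADDENDUM, lead/CONJ-LEAN-SPEC.md,
plean/g19–g22/README, plean/g23/ (gen23/probe_r0.py, cert_r0.py: the g19/g20 Python transcription of `krausTable` + the `TreeN` port).
-/

set_option maxRecDepth 200000

namespace Summit.Ventures.AbcSig.Conjectures
open Summit.Ventures.AbcSig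

/-! ## Two new kernel certificates at `q = 47`: the exponent-residue-`0` classes -/

/-- **Kernel certificate (NEW; entry 0, `q = 47`): the class `(E₁; 1, 1)`** — the reduced class of every `E₁` datum with `23 ∣ m`
(`313^(23k) a²³ + b²³ = (313^k a)²³ + b²³`), outside `lr32Classes 313 23` — is eliminated by `lr32X313` modulo `23` against its own table
(`krausTable .E1 1 1 1 23 47 = [−48, 0, 48]`: the CM trace `0` of `Y² = X³ ± X`; `ψ(c₄₇) = ∓θ ≡ ±8`). -/
theorem lr32Elim313_E1_m0 : lr32X313.Eliminated (lr32ClassAllowed 313 23 (.E1, 1, 1)) 23 :=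
  lr32X313.eliminated_of_checkN _ (.split 0 [(-48, .leaf [[18], [13, 18]]), (0, .leaf [[14], [0, 14]]), (48, .leaf [[18], [10, 18]])]) 23 3
    (by decide +kernel)

/-- **Kernel certificate (NEW; entry 0, `q = 47`): the class `(E₂; 1, 8)`** — the reduced class of every normalised `E₂` datum
(`B ∈ {8·313^m, 8}`) with `23 ∣ m` — is eliminated by `lr32X313` modulo `23` against its own table (`[−48, −12, 0, 12, 48]`). -/
theorem lr32Elim313_E2_m0 : lr32X313.Eliminated (lr32ClassAllowed 313 23 (.E2, 1, 8)) 23 :=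
  lr32X313.eliminated_of_checkN _
    (.split 0 [(-48, .leaf [[18], [13, 18]]), (-12, .leaf [[21], [22, 21]]), (0, .leaf [[14], [0, 14]]), (12, .leaf [[21], [1, 21]]),
      (48, .leaf [[18], [10, 18]])]) 23 3 (by decide +kernel)

/-! ## Every reduced class outside NEGATIVE-21's eight is eliminated (assembly of the certificates of record + the two above) -/
/-- **All reduced `E₁` classes `(E₁; 313^r, 1)`, `(E₁; 1, 313^r)`, `r < 23`, `r ∉ {6, 10, 13, 17}`, are eliminated by `lr32X313` modulo `23`**:
`r = 0` by `lr32Elim313_E1_m0`, `r ∈ {2, 21}` by p533475/p539869 (`lr32Killed1013_elim`), the other 16 residues by p525413 (`lr32Closed313_elim`). -/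
theorem lr32Elim313_E1_reduced (r : ℕ) (hr : r < 23) (h6 : r ≠ 6) (h10 : r ≠ 10) (h13 : r ≠ 13) (h17 : r ≠ 17) :
    lr32X313.Eliminated (lr32ClassAllowed 313 23 (.E1, 313 ^ r, 1)) 23 ∧
      lr32X313.Eliminated (lr32ClassAllowed 313 23 (.E1, 1, 313 ^ r)) 23 := by
  interval_cases r
  all_goals first
    | exact absurd rfl h6 | exact absurd rfl h10 | exact absurd rfl h13 | exact absurd rfl h17 | exact ⟨lr32Elim313_E1_m0, lr32Elim313_E1_m0⟩
    | exact ⟨lr32Closed313_elim _ (by decide +kernel), lr32Closed313_elim _ (by decide +kernel)⟩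
    | exact ⟨lr32Killed1013_elim _ (by decide +kernel), lr32Killed1013_elim _ (by decide +kernel)⟩

/-- **All reduced normalised `E₂` classes `(E₂; 1, 8·313^r)`, `(E₂; 313^r, 8)`, `r < 23`, are eliminated by `lr32X313` modulo `23`**: `r = 0` by
`lr32Elim313_E2_m0`, `(E₂; 1, 8·313³)` and `(E₂; 313²⁰, 8)` by p532105 (`lr32Pending599_elim`, `q = 599`), the other 42 by p525413. -/
theorem lr32Elim313_E2_reduced (r : ℕ) (hr : r < 23) :
    lr32X313.Eliminated (lr32ClassAllowed 313 23 (.E2, 1, 8 * 313 ^ r)) 23 ∧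
      lr32X313.Eliminated (lr32ClassAllowed 313 23 (.E2, 313 ^ r, 8)) 23 := by
  interval_cases r
  all_goals first
    | exact ⟨lr32Elim313_E2_m0, lr32Elim313_E2_m0⟩
    | exact ⟨lr32Closed313_elim _ (by decide +kernel), lr32Closed313_elim _ (by decide +kernel)⟩
    | exact ⟨lr32Pending599_elim _ (by decide +kernel), lr32Closed313_elim _ (by decide +kernel)⟩
    | exact ⟨lr32Closed313_elim _ (by decide +kernel), lr32Pending599_elim _ (by decide +kernel)⟩

/-! ## Coprime distributions of a prime power -/

/-- If `gcd(A, B) = 1` and `A·B = 313^m` then `(A, B) = (313^m, 1)` or `(1, 313^m)`. -/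
theorem dist313 (A B m : ℕ) (hco : Nat.Coprime A B) (hAB : A * B = 313 ^ m) :
    (A = 313 ^ m ∧ B = 1) ∨ (A = 1 ∧ B = 313 ^ m) := by
  have hp : Nat.Prime 313 := by norm_num
  obtain ⟨i, -, rfl⟩ := (Nat.dvd_prime_pow hp).mp (Dvd.intro _ hAB)
  obtain ⟨j, -, rfl⟩ := (Nat.dvd_prime_pow hp).mp (Dvd.intro_left _ hAB)
  have hij : i + j = m := Nat.pow_right_injective hp.two_le (show 313 ^ (i + j) = 313 ^ m by rw [pow_add, hAB])
  rcases Nat.eq_zero_or_pos i with hi | hi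
  · subst hi; right; exact ⟨rfl, by rw [← hij, zero_add]⟩
  rcases Nat.eq_zero_or_pos j with hj | hj
  · subst hj; left; exact ⟨by rw [← hij, add_zero], rfl⟩
  exact absurd (Nat.Coprime.coprime_dvd_right (dvd_pow_self 313 hj.ne') (Nat.Coprime.coprime_dvd_left (dvd_pow_self 313 hi.ne') hco))
    (by decide)

/-- If `gcd(A, B) = 1` and `A·B = 8·313^m` then `(A, B)` is one of `(1, 8·313^m)`, `(313^m, 8)` (BS04's normalisation `2³ ‖ B`) or
`(8·313^m, 1)`, `(8, 313^m)` (`8 ∣ A`). -/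
theorem dist8_313 (A B m : ℕ) (hco : Nat.Coprime A B) (hAB : A * B = 8 * 313 ^ m) :
    (A = 1 ∧ B = 8 * 313 ^ m) ∨ (A = 313 ^ m ∧ B = 8) ∨ 8 ∣ A := by
  have h8 : (8 : ℕ) = 2 ^ 3 := by norm_num
  have hA2B2 : ¬ (2 ∣ A ∧ 2 ∣ B) := fun ⟨hA, hB⟩ => by
    have := Nat.Coprime.eq_one_of_dvd (Nat.Coprime.coprime_dvd_left hA hco) hB; omega
  by_cases hA2 : 2 ∣ A
  · -- then `2 ∤ B`, so `8 ∣ A`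
    right; right
    have hB2 : ¬ 2 ∣ B := fun hB => hA2B2 ⟨hA2, hB⟩
    have hcoB : Nat.Coprime (2 ^ 3) B := (Nat.Coprime.pow_left 3 (Nat.prime_two.coprime_iff_not_dvd.mpr hB2))
    have : 2 ^ 3 ∣ A * B := ⟨313 ^ m, by rw [hAB, h8]⟩
    exact h8 ▸ hcoB.dvd_of_dvd_mul_right this
  · -- `2 ∤ A`: `8 ∣ B`, write `B = 8·B'` with `A·B' = 313^m`
    have hcoA : Nat.Coprime (2 ^ 3) A := (Nat.Coprime.pow_left 3 (Nat.prime_two.coprime_iff_not_dvd.mpr hA2))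
    have h8B : 8 ∣ B := h8 ▸ hcoA.dvd_of_dvd_mul_left (⟨313 ^ m, by rw [hAB, h8]⟩ : 2 ^ 3 ∣ A * B)
    obtain ⟨B', rfl⟩ := h8B
    have hAB' : A * B' = 313 ^ m := by nlinarith [hAB]
    have hco' : Nat.Coprime A B' := Nat.Coprime.coprime_dvd_right (Dvd.intro_left 8 rfl) hco
    rcases dist313 A B' m hco' hAB' with ⟨hA, hB'⟩ | ⟨hA, hB'⟩
    · right; left; exact ⟨hA, by rw [hB']⟩
    · left; exact ⟨hA, by rw [hB']⟩

/-! ## Rescaling a datum inside its class: absorbing `n`-th powers into `a` or `b` -/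

/-- The datum `(A′, B, C; n; t·a, b, c)` — used with `A = A′·tⁿ` (absorb `t` into `a`). A bookkeeping device. -/
def rescaleA (S : FreyDatum) (A' : ℕ) (t : ℤ) : FreyDatum := ⟨A', S.B, S.C, S.n, t * S.a, S.b, S.c⟩

/-- The datum `(A, B′, C; n; a, t·b, c)` — used with `B = B′·tⁿ` (absorb `t` into `b`). A bookkeeping device. -/
def rescaleB (S : FreyDatum) (B' : ℕ) (t : ℤ) : FreyDatum := ⟨S.A, B', S.C, S.n, S.a, t * S.b, S.c⟩

/-- `freyTrace` does not see `A`, `a`: rescaling `a` changes nothing. -/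
theorem freyTrace_rescaleA (μ : FreyModel) (S : FreyDatum) (A' : ℕ) (t : ℤ) (q : ℕ) :
    freyTrace μ (rescaleA S A' t) q = freyTrace μ S q := rfl

/-- With `B = B′·tⁿ`, rescaling `b` changes nothing: the model's `a₄` sees only `B·bⁿ mod q = B′·(t b)ⁿ mod q`. -/
theorem freyTrace_rescaleB (μ : FreyModel) (S : FreyDatum) (B' : ℕ) (t : ℤ) (hBt : (S.B : ℤ) = B' * t ^ S.n) {q : ℕ} (hq : q ≠ 0) :
    freyTrace μ (rescaleB S B' t) q = freyTrace μ S q := by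
  have key : ∀ K : ℕ, B' * S.C * Int.toNat ((t * S.b) ^ S.n % (q : ℤ)) * K % q = S.B * S.C * Int.toNat (S.b ^ S.n % (q : ℤ)) * K % q := by
    intro K
    rw [← ZMod.natCast_eq_natCast_iff']
    push_cast
    rw [natCast_toNat_emod _ hq, natCast_toNat_emod _ hq, show ((S.B : ℕ) : ZMod q) = ((B' : ℤ) * t ^ S.n : ℤ) by rw [← hBt, Int.cast_natCast]]
    push_cast
    ring
  have key1 := key 1
  simp only [mul_one] at key1
  cases μ
  · simp only [freyTrace, FreyModel.coeffs, rescaleB]; rw [key1]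
  · simp only [freyTrace, FreyModel.coeffs, rescaleB]; rw [key]
  · simp only [freyTrace, FreyModel.coeffs, rescaleB]; rw [key]

/-- A prime not dividing the level does not divide `t` — the shape in which the rescaling factor `t = 313^k` enters. -/
theorem not_dvd_pow313_of_not_dvd_level {q : ℕ} (hq : q.Prime) (hqN : ¬ q ∣ 2 ^ 5 * 313) (k : ℕ) : ¬ (q : ℤ) ∣ (313 : ℤ) ^ k := by
  intro h
  have h1 : (q : ℤ) ∣ (313 : ℕ) := by exact_mod_cast (Nat.prime_iff_prime_int.mp hq).dvd_of_dvd_pow h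
  exact hqN ((show q ∣ 313 by exact_mod_cast h1).mul_left _)

/-- **Congruence to the Frey curve is invariant under absorbing into `a` a factor `t` whose prime divisors divide the level.** -/
theorem congruentToFrey_rescaleA (M : NewformModel) {N : ℕ} (f : M.Form N) (n : ℕ) (μ : FreyModel) (S : FreyDatum) (A' : ℕ) (t : ℤ)
    (ht : ∀ q : ℕ, q.Prime → ¬ q ∣ N → ¬ (q : ℤ) ∣ t) (h : CongruentToFrey M f n μ S) : CongruentToFrey M f n μ (rescaleA S A' t) := by
  obtain ⟨K, hK, hchar, ψ, hψ⟩ := h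
  refine ⟨K, hK, hchar, ψ, fun q hq hq2 hqn hqN => ?_⟩
  obtain ⟨hmult, hgood⟩ := hψ q hq hq2 hqn hqN
  have hiff : (q : ℤ) ∣ (rescaleA S A' t).a * (rescaleA S A' t).b ↔ (q : ℤ) ∣ S.a * S.b := by
    show (q : ℤ) ∣ t * S.a * S.b ↔ _
    rw [mul_assoc]
    refine ⟨fun hd => ((Nat.prime_iff_prime_int.mp hq).dvd_or_dvd hd).resolve_left (ht q hq hqN), fun hd => hd.mul_left _⟩
  exact ⟨fun hd => hmult (hiff.mp hd), fun hd => (freyTrace_rescaleA μ S A' t q).symm ▸ hgood (fun h' => hd (hiff.mpr h'))⟩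

/-- **Congruence to the Frey curve is invariant under absorbing into `b` a factor `t` whose prime divisors divide the level, `B = B′·tⁿ`.** -/
theorem congruentToFrey_rescaleB (M : NewformModel) {N : ℕ} (f : M.Form N) (n : ℕ) (μ : FreyModel) (S : FreyDatum) (B' : ℕ) (t : ℤ)
    (ht : ∀ q : ℕ, q.Prime → ¬ q ∣ N → ¬ (q : ℤ) ∣ t) (hBt : (S.B : ℤ) = B' * t ^ S.n) (h : CongruentToFrey M f n μ S) :
    CongruentToFrey M f n μ (rescaleB S B' t) := by
  obtain ⟨K, hK, hchar, ψ, hψ⟩ := h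
  refine ⟨K, hK, hchar, ψ, fun q hq hq2 hqn hqN => ?_⟩
  obtain ⟨hmult, hgood⟩ := hψ q hq hq2 hqn hqN
  have hiff : (q : ℤ) ∣ (rescaleB S B' t).a * (rescaleB S B' t).b ↔ (q : ℤ) ∣ S.a * S.b := by
    show (q : ℤ) ∣ S.a * (t * S.b) ↔ _
    rw [mul_left_comm]
    refine ⟨fun hd => ((Nat.prime_iff_prime_int.mp hq).dvd_or_dvd hd).resolve_left (ht q hq hqN), fun hd => hd.mul_left _⟩
  exact ⟨fun hd => hmult (hiff.mp hd), fun hd => (freyTrace_rescaleB μ S B' t hBt hq.ne_zero).symm ▸ hgood (fun h' => hd (hiff.mpr h'))⟩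

/-! ## CLASS FORCING: the conclusion's `E₁` class is one of NEGATIVE-21's eight -/

/-- **CLASS FORCING (PROVED modulo `hX` = matching the computed datum `lr32X313`).** If a newform `f` of level `2⁵·313` matching `lr32X313`
is congruent above `23` to the Frey curve `E₁(S)` of a datum with `n = 23`, `C = 1`, `gcd(A, B) = 1`, `A·B = 313^m` and
`A a²³ + B b²³ = c²`, then `m mod 23 ∈ {6, 10, 13, 17}`. (No primitivity and no `m ≥ 1` needed: `m = 0` is refuted too.) -/
theorem lr32_E1_class_forced' (M : NewformModel) (f : M.Form (2 ^ 5 * 313)) (hfX : M.Matches f lr32X313) (S : FreyDatum) (m : ℕ)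
    (hn : S.n = 23) (hC : S.C = 1) (hco : Nat.Coprime S.A S.B) (hAB : S.A * S.B = 313 ^ m)
    (heq : (S.A : ℤ) * S.a ^ S.n + S.B * S.b ^ S.n = S.C * S.c ^ 2) (hcong : CongruentToFrey M f 23 .E1 S) :
    m % 23 = 6 ∨ m % 23 = 10 ∨ m % 23 = 13 ∨ m % 23 = 17 := by
  obtain ⟨k, r, hr, hm⟩ : ∃ k r, r < 23 ∧ m = 23 * k + r := ⟨m / 23, m % 23, Nat.mod_lt _ (by norm_num), (Nat.div_add_mod m 23).symm⟩
  rw [show m % 23 = r by omega]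
  by_contra hnot
  obtain ⟨helimA, helimB⟩ := lr32Elim313_E1_reduced r hr (fun h => hnot (Or.inl h)) (fun h => hnot (Or.inr (Or.inl h)))
    (fun h => hnot (Or.inr (Or.inr (Or.inl h)))) (fun h => hnot (Or.inr (Or.inr (Or.inr h))))
  have ht : ∀ q : ℕ, q.Prime → ¬ q ∣ 2 ^ 5 * 313 → ¬ (q : ℤ) ∣ (313 : ℤ) ^ k := fun q hq hqN => not_dvd_pow313_of_not_dvd_level hq hqN k
  have hpow : ∀ q : ℕ, q.Prime → q ≠ 313 → ¬ q ∣ 313 ^ r :=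
    fun q hq hq313 hd => hq313 ((Nat.prime_dvd_prime_iff_eq hq (by norm_num)).mp (hq.dvd_of_dvd_pow hd))
  rcases dist313 S.A S.B m hco hAB with ⟨hA, hB⟩ | ⟨hA, hB⟩
  · -- distribution `(313^m, 1)`: absorb `313^k` into `a`, class `(E₁; 313^r, 1)`
    have hcong' := congruentToFrey_rescaleA M f 23 .E1 S (313 ^ r) ((313 : ℤ) ^ k) ht hcong
    rw [← hn] at hcong'
    have hsol' : ((313 ^ r : ℕ) : ℤ) * ((313 : ℤ) ^ k * S.a) ^ S.n + S.B * S.b ^ S.n = S.C * S.c ^ 2 := by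
      rw [← heq, hA, hn, hm]; push_cast; ring
    have hA' := arisesMod_lr32ClassAllowed_of_congruentToFrey M f .E1 (rescaleA S (313 ^ r) (313 ^ k)) hsol' hC
      (fun q hq _ hq313 hd => hpow q hq hq313 (by simpa [rescaleA, hB] using hd)) hcong'
    simp only [rescaleA, hn, hB] at hA'
    exact M.not_arisesMod_of_eliminated f lr32X313 hfX 23 _ helimA lr32X313_wellformed hA'
  · -- distribution `(1, 313^m)`: absorb `313^k` into `b`, class `(E₁; 1, 313^r)`
    have hBt : (S.B : ℤ) = ((313 ^ r : ℕ) : ℤ) * ((313 : ℤ) ^ k) ^ S.n := by rw [hB, hn, hm]; push_cast; ring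
    have hcong' := congruentToFrey_rescaleB M f 23 .E1 S (313 ^ r) ((313 : ℤ) ^ k) ht hBt hcong
    rw [← hn] at hcong'
    have hsol' : (S.A : ℤ) * S.a ^ S.n + ((313 ^ r : ℕ) : ℤ) * ((313 : ℤ) ^ k * S.b) ^ S.n = S.C * S.c ^ 2 := by
      rw [← heq, hB, hn, hm]; push_cast; ring
    have hA' := arisesMod_lr32ClassAllowed_of_congruentToFrey M f .E1 (rescaleB S (313 ^ r) (313 ^ k)) hsol' hC
      (fun q hq _ hq313 hd => hpow q hq hq313 (by simpa [rescaleB, hA] using hd)) hcong'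
    simp only [rescaleB, hn, hA] at hA'
    exact M.not_arisesMod_of_eliminated f lr32X313 hfX 23 _ helimB lr32X313_wellformed hA'

/-- **CLASS FORCING for `E₁` data of the residual's conclusion** (`LR32E1Datum S m`), modulo `hX` only: `m mod 23 ∈ {6, 10, 13, 17}`. -/
theorem lr32_E1_class_forced (M : NewformModel) (f : M.Form (2 ^ 5 * 313)) (hfX : M.Matches f lr32X313) (S : FreyDatum) (m : ℕ)
    (hS : LR32E1Datum S m) (hcong : CongruentToFrey M f 23 .E1 S) : m % 23 = 6 ∨ m % 23 = 10 ∨ m % 23 = 13 ∨ m % 23 = 17 :=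
  lr32_E1_class_forced' M f hfX S m hS.1 hS.2.1 hS.2.2.2.1 hS.2.2.2.2.2 hS.eqn hcong

/-- In particular **`23 ∤ m`**: the «`23 ∣ m ∨`» disjunct of the SYMPL survivor condition (p544524) is PROVABLY VACUOUS. -/
theorem lr32_E1_not_dvd (M : NewformModel) (f : M.Form (2 ^ 5 * 313)) (hfX : M.Matches f lr32X313) (S : FreyDatum) (m : ℕ)
    (hS : LR32E1Datum S m) (hcong : CongruentToFrey M f 23 .E1 S) : ¬ 23 ∣ m := by
  have := lr32_E1_class_forced M f hfX S m hS hcong; omega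

/-- **The `E₂` companion: no NORMALISED `E₂` datum (`B ∈ {8·313^m, 8}`, `C = 1`, `n = 23`) is congruent above `23` to a newform matching
`lr32X313`** — every reduced class `(E₂; 1, 8·313^r)`, `(E₂; 313^r, 8)` is eliminated (`lr32Elim313_E2_reduced`). Modulo `hX` only. -/
theorem lr32_E2_excluded (M : NewformModel) (f : M.Form (2 ^ 5 * 313)) (hfX : M.Matches f lr32X313) (S : FreyDatum) (m : ℕ)
    (hn : S.n = 23) (hC : S.C = 1) (hdist : (S.A = 1 ∧ S.B = 8 * 313 ^ m) ∨ (S.A = 313 ^ m ∧ S.B = 8))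
    (heq : (S.A : ℤ) * S.a ^ S.n + S.B * S.b ^ S.n = S.C * S.c ^ 2) (hcong : CongruentToFrey M f 23 .E2 S) : False := by
  obtain ⟨k, r, hr, hm⟩ : ∃ k r, r < 23 ∧ m = 23 * k + r := ⟨m / 23, m % 23, Nat.mod_lt _ (by norm_num), (Nat.div_add_mod m 23).symm⟩
  obtain ⟨helimB, helimA⟩ := lr32Elim313_E2_reduced r hr
  have ht : ∀ q : ℕ, q.Prime → ¬ q ∣ 2 ^ 5 * 313 → ¬ (q : ℤ) ∣ (313 : ℤ) ^ k := fun q hq hqN => not_dvd_pow313_of_not_dvd_level hq hqN k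
  have hpow : ∀ q : ℕ, q.Prime → q ≠ 2 → q ≠ 313 → ¬ q ∣ 8 * 313 ^ r := by
    intro q hq hq2 hq313 hd
    rcases (Nat.Prime.dvd_mul hq).mp hd with h | h
    · exact hq2 ((Nat.prime_dvd_prime_iff_eq hq Nat.prime_two).mp (hq.dvd_of_dvd_pow (show q ∣ 2 ^ 3 by simpa using h)))
    · exact hq313 ((Nat.prime_dvd_prime_iff_eq hq (by norm_num)).mp (hq.dvd_of_dvd_pow h))
  rcases hdist with ⟨hA, hB⟩ | ⟨hA, hB⟩
  · -- `(1, 8·313^m)`: absorb into `b`, class `(E₂; 1, 8·313^r)`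
    have hBt : (S.B : ℤ) = ((8 * 313 ^ r : ℕ) : ℤ) * ((313 : ℤ) ^ k) ^ S.n := by rw [hB, hn, hm]; push_cast; ring
    have hcong' := congruentToFrey_rescaleB M f 23 .E2 S (8 * 313 ^ r) ((313 : ℤ) ^ k) ht hBt hcong
    rw [← hn] at hcong'
    have hsol' : (S.A : ℤ) * S.a ^ S.n + ((8 * 313 ^ r : ℕ) : ℤ) * ((313 : ℤ) ^ k * S.b) ^ S.n = S.C * S.c ^ 2 := by
      rw [← heq, hB, hn, hm]; push_cast; ring
    have hA' := arisesMod_lr32ClassAllowed_of_congruentToFrey M f .E2 (rescaleB S (8 * 313 ^ r) (313 ^ k)) hsol' hC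
      (fun q hq hq2 hq313 hd => hpow q hq hq2 hq313 (by simpa [rescaleB, hA] using hd)) hcong'
    simp only [rescaleB, hn, hA] at hA'
    exact M.not_arisesMod_of_eliminated f lr32X313 hfX 23 _ helimB lr32X313_wellformed hA'
  · -- `(313^m, 8)`: absorb into `a`, class `(E₂; 313^r, 8)`
    have hcong' := congruentToFrey_rescaleA M f 23 .E2 S (313 ^ r) ((313 : ℤ) ^ k) ht hcong
    rw [← hn] at hcong'
    have hsol' : ((313 ^ r : ℕ) : ℤ) * ((313 : ℤ) ^ k * S.a) ^ S.n + S.B * S.b ^ S.n = S.C * S.c ^ 2 := by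
      rw [← heq, hA, hn, hm]; push_cast; ring
    have hA' := arisesMod_lr32ClassAllowed_of_congruentToFrey M f .E2 (rescaleA S (313 ^ r) (313 ^ k)) hsol' hC
      (fun q hq hq2 hq313 hd => hpow q hq hq2 hq313 (by simpa [rescaleA, hB, mul_comm] using hd)) hcong'
    simp only [rescaleA, hn, hB] at hA'
    exact M.not_arisesMod_of_eliminated f lr32X313 hfX 23 _ helimA lr32X313_wellformed hA'

/-! ## With SYMPL: the survivor residues `{6, 13}` on the conclusion side -/

/-- **CLASS FORCING + SYMPL: `m mod 23 ∈ {6, 13}` for EVERY `E₁` datum congruent above `23` to a newform matching `10016.1`** — p544524's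
`lr32_sympl_exponent_mod` with its residue hypothesis `hr` DISCHARGED by `lr32_E1_class_forced`. Modulo `hX`, `hX223` (COMPUTED) and `HS313`,
`HS223` (TYPED). The registrar's survivor set `{6, −10} × {D1, D2}` (HOME/STRUCTURE.md v3.29) as a statement about the solution. -/
theorem lr32_sympl_class (M : NewformModel) (ε : FreyDatum → ℤ) (h313 : HS313 M ε) (h223 : HS223 M ε)
    (hX : ∀ f : M.Form (2 ^ 5 * 313), M.Matches f orbit_10016_1 → M.Matches f lr32X313)
    (hX223 : ∀ f : M.Form (2 ^ 5 * 313), M.Matches f orbit_10016_1 → M.Matches f lr32X313c)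
    (f : M.Form (2 ^ 5 * 313)) (hf : M.Matches f orbit_10016_1) (S : FreyDatum) (m : ℕ) (hS : LR32E1Datum S m)
    (hcong : CongruentToFrey M f 23 .E1 S) : m % 23 = 6 ∨ m % 23 = 13 :=
  lr32_sympl_exponent_mod M ε h313 h223 hX223 f hf S m hS hcong (by
    simp only [List.mem_cons, List.not_mem_nil, or_false]
    exact lr32_E1_class_forced M f (hX f hf) S m hS hcong)

/-- The survivor residues pass the SYMPL survivor condition as typed in p544524 (`(6/23) = (13/23) = +1`). -/
theorem legendreNaive_of_survivor (m : ℕ) (h : m % 23 = 6 ∨ m % 23 = 13) : 23 ∣ m ∨ legendreNaive 23 m = 1 := by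
  right
  rw [legendreNaive_mod]
  rcases h with h | h <;> rw [h] <;> decide

/-! ## The residual with the FORCED conclusion -/

/-- **`LR32Residual313Forced M 𝒯` — the open instance `(313; 23)` with the conclusion's class FORCED.** VERBATIM `LR32Residual313E M`
(p539869: for every newform `f` of level `2⁵·313` matching `10016.1` and every one of NEGATIVE-21's eight classes `κ`, if `f` passes the coarse
sets and the Kraus table of `κ` at every auxiliary prime modulo a prime above `23`, then `f` is congruent above `23` to the Frey curve of a
primitive solution `A a²³ + B b²³ = c²`, `gcd(A, B) = 1`, `A·B = 313^m` (`E₁`) or `2³·313^m` (`E₂`), `m ≥ 1`) EXCEPT that (i) the `E₁` branch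
of the conclusion carries **`m % 23 = 6 ∨ m % 23 = 13`** (PROVED part `∈ {6, 10, 13, 17}`: `lr32_E1_class_forced`, mod `hX`; the cut to
`{6, 13}` is SYMPL, TYPED) and the `(1+i)` cell clause «case (i) as printed ⇒ `(v₂(c), B·b²³ mod 16) ∈ 𝒯`» (p551031's socket `HI2Cells M 𝒯`
carried INTO the conclusion; booked instance `𝒯 = inertia2CellsBooked`, COMPUTED), and (ii) the `E₂` branch carries **`8 ∣ A`** — the
normalised half `2³ ‖ B` is EMPTY by `lr32_E2_excluded` (mod `hX`); the un-normalised half is not addressed by any certificate of record and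
is kept. Equivalent to `LR32Residual313E M` modulo `hX`, `hX223` (COMPUTED), `HS313`, `HS223`, `HI2Cells M 𝒯` (TYPED). OPEN for every `𝒯`;
an HYPOTHESIS wherever taken; MEANINGFUL ONLY FOR THE INTENDED MODEL; NOT a decision of Q(313; 23); nothing about ABC. -/
def LR32Residual313Forced (M : NewformModel) (𝒯 : Set (ℕ × ZMod 16)) : Prop :=
  ∀ f : M.Form (2 ^ 5 * 313), M.Matches f orbit_10016_1 → ∀ κ ∈ lr32Residual313ClassesE,
    M.ArisesMod f 23 (lr32ClassAllowed 313 23 κ) →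
      ∃ (S : FreyDatum) (m : ℕ), S.n = 23 ∧ S.C = 1 ∧ 1 ≤ m ∧ Nat.Coprime S.A S.B ∧
        IsPrimitiveSolution S.A S.B 1 23 S.a S.b S.c ∧
        ((S.A * S.B = 313 ^ m ∧ CongruentToFrey M f 23 .E1 S ∧ (m % 23 = 6 ∨ m % 23 = 13) ∧
            (FreyCase.i.Holds S.A S.B S.C S.n S.a S.b S.c →
              (padicValInt 2 S.c, (((S.B : ℤ) * S.b ^ 23 : ℤ) : ZMod 16)) ∈ 𝒯)) ∨
          (S.A * S.B = 2 ^ 3 * 313 ^ m ∧ 8 ∣ S.A ∧ CongruentToFrey M f 23 .E2 S))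

/-- **Forget the forcing: the forced residual implies p551031's `LR32Residual313Inertia2 M T`** for every `T` containing the first projection
of `𝒯` (so, with `T = Prod.fst '' 𝒯`, also `LR32Residual313Sympl M` and `LR32Residual313E M` by p551031/p544524's forgetful lemmas). -/
theorem LR32Residual313Inertia2_of_forced (M : NewformModel) (𝒯 : Set (ℕ × ZMod 16)) (T : Set ℕ) (hT : ∀ p ∈ 𝒯, p.1 ∈ T)
    (h : LR32Residual313Forced M 𝒯) : LR32Residual313Inertia2 M T := by
  intro f hf κ hκ hA
  obtain ⟨S, m, hn, hC, hm, hco, hsol, hbr⟩ := h f hf κ hκ hA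
  refine ⟨S, m, hn, hC, hm, hco, hsol, ?_⟩
  rcases hbr with ⟨hAB, hcong, hcl, hcell⟩ | ⟨hAB, -, hcong⟩
  · exact Or.inl ⟨hAB, hcong, legendreNaive_of_survivor m hcl, fun hcase => hT _ (hcell hcase)⟩
  · exact Or.inr ⟨hAB, hcong⟩

/-- In particular the forced residual implies the eight-class residual of record. -/
theorem LR32Residual313E_of_forced (M : NewformModel) (𝒯 : Set (ℕ × ZMod 16)) (h : LR32Residual313Forced M 𝒯) : LR32Residual313E M :=
  LR32Residual313E_of_sympl M (LR32Residual313Sympl_of_inertia2 M _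
    (LR32Residual313Inertia2_of_forced M 𝒯 (Prod.fst '' 𝒯) (fun p hp => ⟨p, hp, rfl⟩) h))

/-- **The eight-class residual implies the forced one**, modulo `hX`, `hX223` (COMPUTED), `HS313`, `HS223` and `HI2Cells M 𝒯` (TYPED): the `E₁`
datum delivered by the residual has `m % 23 ∈ {6, 13}` (`lr32_sympl_class`) and its cell in `𝒯`; an `E₂` datum delivered by it cannot be
normalised (`lr32_E2_excluded` on the two normalised distributions of `dist8_313`), so `8 ∣ A`. -/
theorem LR32Residual313Forced_of_E (M : NewformModel) (ε : FreyDatum → ℤ) (h313 : HS313 M ε) (h223 : HS223 M ε)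
    (hX : ∀ f : M.Form (2 ^ 5 * 313), M.Matches f orbit_10016_1 → M.Matches f lr32X313)
    (hX223 : ∀ f : M.Form (2 ^ 5 * 313), M.Matches f orbit_10016_1 → M.Matches f lr32X313c)
    (𝒯 : Set (ℕ × ZMod 16)) (h𝒯 : HI2Cells M 𝒯) (h : LR32Residual313E M) : LR32Residual313Forced M 𝒯 := by
  intro f hf κ hκ hA
  obtain ⟨S, m, hn, hC, hm, hco, hsol, hbr⟩ := h f hf κ hκ hA
  refine ⟨S, m, hn, hC, hm, hco, hsol, ?_⟩
  rcases hbr with ⟨hAB, hcong⟩ | ⟨hAB, hcong⟩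
  · have hS : LR32E1Datum S m := ⟨hn, hC, hm, hco, hsol, hAB⟩
    exact Or.inl ⟨hAB, hcong, lr32_sympl_class M ε h313 h223 hX hX223 f hf S m hS hcong,
      fun hcase => h𝒯 f hf S m hS hcase hcong⟩
  · refine Or.inr ⟨hAB, ?_, hcong⟩
    have heq : (S.A : ℤ) * S.a ^ S.n + S.B * S.b ^ S.n = S.C * S.c ^ 2 := by rw [hn, hC]; exact hsol.1
    rcases dist8_313 S.A S.B m hco (by rw [hAB]; norm_num) with hd | hd | h8
    · exact (lr32_E2_excluded M f (hX f hf) S m hn hC (Or.inl hd) heq hcong).elim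
    · exact (lr32_E2_excluded M f (hX f hf) S m hn hC (Or.inr hd) heq hcong).elim
    · exact h8

/-- **`LR32Residual313E M ↔ LR32Residual313Forced M 𝒯`** modulo `hX`, `hX223` (COMPUTED), `HS313`, `HS223`, `HI2Cells M 𝒯` (TYPED). -/
theorem LR32Residual313Forced_iff (M : NewformModel) (ε : FreyDatum → ℤ) (h313 : HS313 M ε) (h223 : HS223 M ε)
    (hX : ∀ f : M.Form (2 ^ 5 * 313), M.Matches f orbit_10016_1 → M.Matches f lr32X313)
    (hX223 : ∀ f : M.Form (2 ^ 5 * 313), M.Matches f orbit_10016_1 → M.Matches f lr32X313c)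
    (𝒯 : Set (ℕ × ZMod 16)) (h𝒯 : HI2Cells M 𝒯) : LR32Residual313E M ↔ LR32Residual313Forced M 𝒯 :=
  ⟨LR32Residual313Forced_of_E M ε h313 h223 hX hX223 𝒯 h𝒯, LR32Residual313E_of_forced M 𝒯⟩

/-- **`CONJ_LR32_L2` at `ℓ = 313` with the conclusion's class FORCED.** Modulo EXACTLY: `hD`, `hCP`, `hX` (p525413/p539869, COMPUTED), `hX223`
(COMPUTED), `HS313`, `HS223` (TYPED local symplectic criteria, p544524) and `HI2Cells M 𝒯` (TYPED `(1+i)` cell datum, p551031):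
`CONJ_LR32_L2At M 313 ↔ LR32Residual313Forced M 𝒯` — the `E₁` branch of the conclusion says the solution lies in one of the registrar's FOUR
survivor classes `m ≡ 6, −10 (mod 23)` × {D1, D2} (the part `m mod 23 ∈ {±6, ±10}`, i.e. «one of NEGATIVE-21's eight», PROVED from `hX` alone)
with its `(1+i)` cell in `𝒯`, and the `E₂` branch is confined to `8 ∣ A`. Kernel face of `CONJ_LR32_L2` UNCHANGED (62 + 1 REDUCED + 1 OOS / 64).
Q(313; 23) is NOT decided; typed ≠ proved; computed ≠ proved; nothing about ABC or any summit. -/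
theorem CONJ_LR32_L2At_313_iff_forced (M : NewformModel) (hD : M.DataComplete 10016 level10016Orbits)
    (hCP : M.RefinesCPSymAll 10016 level10016CP)
    (hX : ∀ f : M.Form (2 ^ 5 * 313), M.Matches f orbit_10016_1 → M.Matches f lr32X313)
    (hX223 : ∀ f : M.Form (2 ^ 5 * 313), M.Matches f orbit_10016_1 → M.Matches f lr32X313c)
    (ε : FreyDatum → ℤ) (h313 : HS313 M ε) (h223 : HS223 M ε) (𝒯 : Set (ℕ × ZMod 16)) (h𝒯 : HI2Cells M 𝒯) :
    CONJ_LR32_L2At M 313 ↔ LR32Residual313Forced M 𝒯 :=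
  (CONJ_LR32_L2At_313_iff₈ M hD hCP hX).trans (LR32Residual313Forced_iff M ε h313 h223 hX hX223 𝒯 h𝒯)

/-- **The BOOKED reading** (`𝒯 = inertia2CellsBooked` = `{(2; 3), (2; 7)} ∪ {(k; 11), (k; 15) : k ≥ 3}`, HOME/STRUCTURE.md v3.34, COMPUTED):
`CONJ_LR32_L2At M 313 ↔ LR32Residual313Forced M inertia2CellsBooked`. Inside the cell's framework the `E₁` survivor is: `m ≡ 6, −10 (mod 23)`,
either distribution, and in case (i) as printed `4 ∣ z` with `(v₂(z), D mod 16)` in the booked cells (registrar's `b`-words: p551031's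
`zmod16_bwords_table`). NOT a decision of Q(313; 23); nothing about ABC. -/
theorem CONJ_LR32_L2At_313_iff_forced_booked (M : NewformModel) (hD : M.DataComplete 10016 level10016Orbits)
    (hCP : M.RefinesCPSymAll 10016 level10016CP)
    (hX : ∀ f : M.Form (2 ^ 5 * 313), M.Matches f orbit_10016_1 → M.Matches f lr32X313)
    (hX223 : ∀ f : M.Form (2 ^ 5 * 313), M.Matches f orbit_10016_1 → M.Matches f lr32X313c)
    (ε : FreyDatum → ℤ) (h313 : HS313 M ε) (h223 : HS223 M ε) (h𝒯 : HI2Cells M inertia2CellsBooked) :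
    CONJ_LR32_L2At M 313 ↔ LR32Residual313Forced M inertia2CellsBooked :=
  CONJ_LR32_L2At_313_iff_forced M hD hCP hX hX223 ε h313 h223 inertia2CellsBooked h𝒯

/-- The booked forced residual implies p551031's booked reading (`T = inertia2Booked`, «case (i) ⇒ `4 ∣ z`»): the cells project into `{k ≥ 2}`. -/
theorem LR32Residual313Inertia2_booked_of_forced (M : NewformModel) (h : LR32Residual313Forced M inertia2CellsBooked) :
    LR32Residual313Inertia2 M inertia2Booked :=
  LR32Residual313Inertia2_of_forced M _ _ (fun p hp => by rcases hp with ⟨h2, -⟩ | ⟨h3, -⟩ <;> (change 2 ≤ p.1; omega)) h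

end Summit.Ventures.AbcSig.Conjectures
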